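import Literature.Geometry.Riemannian.RicciFlowChartSpatialBounds
import HarnessLib

/-!
# Curvature blow-up, the CLAIM of Topping's proof: bounds on the chart representative and its Ricci form
(topic `Geometry/Riemannian`)

Companion of `RicciFlowChartSpatialBounds.lean` for the named fact
`Literature.Geometry.Riemannian.ricciFlow_curvature_blowup` (**Topping 2006, Thm. 5.3.1**): the
order-zero inputs of the conversion of curvature bounds into chart bounds in the proof of the
CLAIM, p. 47. Along a Ricci flow of Riemannian metrics on `[0, T)` with `|Rm| ≤ K` (frame form),
in the chart at `z`, on a closed ball `B̄(ẑ, r') ⊆ target` and for all `t ∈ [0, T)`: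

* `IsRicciFlow.exists_chartRep_twoSided` — **the chart representative `G_t(y)` is uniformly
  positive definite and bounded**: `λ|v|² ≤ G_t(y)(v,v)` and `‖G_t(y)‖ ≤ C₀` (Topping's Lemma
  5.3.2, `metric_equivalence_of_curvatureBoundedBy`, the uniform positivity and boundedness of
  `G_0` on the compact ball, and polarization `MetricCoord.norm_le_of_quadratic_le`);
* `IsRicciFlow.ricAt_chartRep_eq_ricci` — the coordinate Ricci form of the representative is
  the Ricci tensor of `g(t)` on the frame vectors (naturality of `Ric` under the inverse chart);
* `IsRicciFlow.exists_abs_ricAt_chartRep_le` — **the components `R_{ij}(y,t) = Ric(b_i,b_j)` of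
  the representative are bounded** (`|Ric(X,X)| ≤ nK g(X,X)`, `CurvatureBoundedBy.abs_ricci_le`,
  polarization, and the bound on `G`): the case `k = 0` of the covariant Ricci bounds entering
  (5.3.3) ⇒ (5.3.4).

Everything is proved; no named fact is introduced (D-0026).

## References

* P. Topping, *Lectures on the Ricci flow*, LMS Lecture Note Series 325, Cambridge Univ. Press
  2006, §5.3, Lemma 5.3.2 and the proof of Thm. 5.3.1, p. 47. [Topping2006]
-/

noncomputable section

set_option maxSynthPendingDepth 3

open Bundle Set Filter Function Metric Real Module
open scoped Manifold ContDiff Topology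

/-! ### Polarization: the operator norm of a symmetric form from its quadratic form -/

namespace Literature.Geometry.Lorentzian

namespace MetricCoord

variable {E : Type*} [NormedAddCommGroup E] [NormedSpace ℝ E]

/-- **The operator norm of a symmetric bilinear form from its quadratic form**: if
`|A(v,v)| ≤ c|v|²` and `A` is symmetric then `‖A‖ ≤ 2c` (polarization and rescaling). [folklore] -/
theorem norm_le_of_quadratic_le {A : E →L[ℝ] E →L[ℝ] ℝ} (hsymm : ∀ v w, A v w = A w v) {c : ℝ}
    (hc : 0 ≤ c) (h : ∀ v, |A v v| ≤ c * ‖v‖ ^ 2) : ‖A‖ ≤ 2 * c := by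
  -- `|A(v',w')| ≤ c (|v'|² + |w'|²)`
  have key : ∀ v' w' : E, |A v' w'| ≤ c * (‖v'‖ ^ 2 + ‖w'‖ ^ 2) := by
    intro v' w'
    have hpol : A v' w' = 4⁻¹ * (A (v' + w') (v' + w') - A (v' - w') (v' - w')) := by
      simp only [map_add, map_sub, _root_.add_apply, _root_.sub_apply, hsymm w' v']
      ring
    have hpar : ‖v' + w'‖ ^ 2 + ‖v' - w'‖ ^ 2 ≤ 4 * (‖v'‖ ^ 2 + ‖w'‖ ^ 2) := by
      nlinarith [norm_add_le v' w', norm_sub_le v' w', norm_nonneg (v' + w'), norm_nonneg (v' - w'),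
        norm_nonneg v', norm_nonneg w', sq_nonneg (‖v'‖ - ‖w'‖)]
    rw [hpol, abs_mul, abs_of_pos (by norm_num : (0 : ℝ) < 4⁻¹)]
    calc 4⁻¹ * |A (v' + w') (v' + w') - A (v' - w') (v' - w')|
        ≤ 4⁻¹ * (|A (v' + w') (v' + w')| + |A (v' - w') (v' - w')|) := by
          gcongr; exact abs_sub _ _
      _ ≤ 4⁻¹ * (c * ‖v' + w'‖ ^ 2 + c * ‖v' - w'‖ ^ 2) := by gcongr <;> exact h _
      _ = 4⁻¹ * (c * (‖v' + w'‖ ^ 2 + ‖v' - w'‖ ^ 2)) := by ring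
      _ ≤ 4⁻¹ * (c * (4 * (‖v'‖ ^ 2 + ‖w'‖ ^ 2))) := by gcongr
      _ = c * (‖v'‖ ^ 2 + ‖w'‖ ^ 2) := by ring
  refine ContinuousLinearMap.opNorm_le_bound₂ _ (by positivity) fun v w ↦ ?_
  rw [Real.norm_eq_abs]
  by_cases hv : v = 0
  · subst hv; simp
  by_cases hw : w = 0
  · subst hw; simp
  have hvpos : 0 < ‖v‖ := norm_pos_iff.2 hv
  have hwpos : 0 < ‖w‖ := norm_pos_iff.2 hw
  set s : ℝ := Real.sqrt (‖w‖ / ‖v‖) with hsdef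
  have hspos : 0 < s := Real.sqrt_pos.2 (div_pos hwpos hvpos)
  have hss : s * s = ‖w‖ / ‖v‖ := Real.mul_self_sqrt (div_pos hwpos hvpos).le
  have hscale : A v w = A (s • v) (s⁻¹ • w) := by
    simp only [map_smul, FunLike.coe_smul, Pi.smul_apply, smul_eq_mul]
    field_simp
  have hn1 : ‖s • v‖ ^ 2 = ‖v‖ * ‖w‖ := by
    rw [norm_smul, Real.norm_eq_abs, abs_of_pos hspos, mul_pow, sq s, hss]
    field_simp
  have hn2 : ‖s⁻¹ • w‖ ^ 2 = ‖v‖ * ‖w‖ := by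
    rw [norm_smul, norm_inv, Real.norm_eq_abs, abs_of_pos hspos, mul_pow, inv_pow, sq s, hss]
    field_simp
  rw [hscale]
  calc |A (s • v) (s⁻¹ • w)| ≤ c * (‖s • v‖ ^ 2 + ‖s⁻¹ • w‖ ^ 2) := key _ _
    _ = 2 * c * ‖v‖ * ‖w‖ := by rw [hn1, hn2]; ring

/-- Entries of a bilinear form are bounded by the operator norm: `|A(v,w)| ≤ ‖A‖|v||w|`.
[folklore] -/
theorem abs_apply₂_le (A : E →L[ℝ] E →L[ℝ] ℝ) (v w : E) : |A v w| ≤ ‖A‖ * ‖v‖ * ‖w‖ := by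
  have h := A.le_opNorm₂ v w
  rwa [Real.norm_eq_abs] at h

end MetricCoord

end Literature.Geometry.Lorentzian

/-! ### The chart representative of a Ricci flow with bounded curvature -/

namespace Literature.Geometry.Riemannian

open Lorentzian Lorentzian.PseudoRiemannianMetric Lorentzian.MetricCoord

universe u v w

variable {E : Type u} [NormedAddCommGroup E] [NormedSpace ℝ E] [FiniteDimensional ℝ E]
  [CompleteSpace E] {H : Type v} [TopologicalSpace H] {I : ModelWithCorners ℝ E H} [I.Boundaryless]
  {M : Type w} [TopologicalSpace M] [ChartedSpace H M] [IsManifold I ∞ M]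
  {g : ℝ → PseudoRiemannianMetric I ∞ E (TangentSpace I : M → Type _)}
  {cov : ℝ → CovariantDerivative I E (TangentSpace I : M → Type _)} {T K : ℝ} {S : Set ℝ}

omit [CompleteSpace E] in
/-- The chart representative of a metric is a symmetric form at the points of the chart target.
[folklore] -/
theorem chartRep_symm (z : M) (t : ℝ) {y : E} (hy : y ∈ (extChartAt I z).target) (v w : E) :
    chartRep I g z t y v w = chartRep I g z t y w v :=
  (Lorentzian.OpensChart.isMetricOn_repr (val_chartPullback_eq_chartRep g z t)).symm y hy v w

/-- **The chart representative is uniformly positive definite and bounded** (Topping 2006,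
Lemma 5.3.2 and p. 47): along a Ricci flow of Riemannian metrics on `[0, T)`, `T > 0`, with
`|Rm| ≤ K` (frame form), on a closed ball `B̄(ẑ, r') ⊆ target` there are `λ > 0` and `C₀` with
`λ|v|² ≤ G_t(y)(v,v)` and `‖G_t(y)‖ ≤ C₀` for all `y ∈ B̄(ẑ, r')`, `t ∈ [0, T)`: by Lemma 5.3.2,
`e^{-2nKt} G_0 ≤ G_t ≤ e^{2nKt} G_0`, and `G_0` is positive definite and continuous on the compact
ball. [cite: Topping2006, Lemma 5.3.2] [cite: Topping2006, §5.3, proof of Thm. 5.3.1, p. 47] -/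
theorem IsRicciFlow.exists_chartRep_twoSided (hT : 0 < T) (hg : IsRicciFlow g cov (Ico 0 T))
    (hR : ∀ t ∈ Ico 0 T, (g t).IsRiemannian) (hK : ∀ t ∈ Ico 0 T, CurvatureBoundedBy (g t) (cov t) K)
    (z : M) {r' : ℝ} (hr' : 0 ≤ r') (hcl : closedBall (extChartAt I z z) r' ⊆ (extChartAt I z).target) :
    ∃ lam > (0 : ℝ), ∃ C₀ : ℝ, ∀ q ∈ closedBall (extChartAt I z z) r' ×ˢ Ico 0 T,
      (∀ v : E, lam * ‖v‖ ^ 2 ≤ chartRep I g z q.2 q.1 v v) ∧ ‖chartRep I g z q.2 q.1‖ ≤ C₀ := by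
  set y₀ : E := extChartAt I z z with hy₀
  have h0T : (0 : ℝ) ∈ Ico 0 T := ⟨le_rfl, hT⟩
  have hG0 : ContinuousOn (chartRep I g z 0) (closedBall y₀ r') := by
    have hsm : ContDiffOn ℝ ∞ (fun q : E × ℝ ↦ chartRep I g z q.2 q.1)
        ((extChartAt I z).target ×ˢ Ico 0 T) := contDiffOn_chartRep hg.smooth z
    have hι : ContinuousOn (fun y : E ↦ ((y, (0 : ℝ)) : E × ℝ)) (closedBall y₀ r') :=
      (continuous_id.prodMk continuous_const).continuousOn
    have hcomp := hsm.continuousOn.comp hι fun y hy ↦ ⟨hcl hy, h0T⟩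
    exact hcomp
  obtain ⟨lam₀, hlam₀, hlam₀le⟩ := exists_pos_le_quadratic_of_isCompact (isCompact_closedBall y₀ r') hG0
    (fun y hy v hv ↦ chartRep_pos (hR 0 h0T) z ⟨y, hcl hy⟩ v hv)
  obtain ⟨M₀, hM₀⟩ := (isCompact_closedBall y₀ r').exists_bound_of_continuousOn hG0
  set L : ℝ := finrank ℝ E * K with hLdef
  have hL0 : 0 ≤ L := mul_nonneg (Nat.cast_nonneg _) ((hK 0 h0T).nonneg z)
  set c : ℝ := exp (-(2 * L * T)) with hcdef
  have hcpos : 0 < c := exp_pos _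
  set C : ℝ := exp (2 * L * T) with hCdef
  have hCpos : 0 < C := exp_pos _
  have hM₀nn : 0 ≤ M₀ := (norm_nonneg _).trans (hM₀ y₀ (mem_closedBall_self hr'))
  -- the two-sided comparison in the chart
  have hcomp : ∀ q ∈ closedBall y₀ r' ×ˢ Ico 0 T, ∀ v : E,
      c * lam₀ * ‖v‖ ^ 2 ≤ chartRep I g z q.2 q.1 v v ∧ chartRep I g z q.2 q.1 v v ≤ C * M₀ * ‖v‖ ^ 2 := by
    rintro ⟨y, t⟩ ⟨hy, ht⟩ v
    have hme := hg.metric_equivalence_of_curvatureBoundedBy hR hK t ht ((extChartAt I z).symm y)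
      ((trivializationAt E (TangentSpace I : M → Type _) z).symmL ℝ ((extChartAt I z).symm y) v)
    change exp (-(2 * (finrank ℝ E * K) * t)) * chartRep I g z 0 y v v ≤ chartRep I g z t y v v ∧
      chartRep I g z t y v v ≤ exp (2 * (finrank ℝ E * K) * t) * chartRep I g z 0 y v v at hme
    rw [← hLdef] at hme
    have h0 := hlam₀le y hy v
    have hg0 : 0 ≤ chartRep I g z 0 y v v := (mul_nonneg hlam₀.le (sq_nonneg _)).trans h0
    have hup : chartRep I g z 0 y v v ≤ M₀ * ‖v‖ ^ 2 := by
      have h1 : chartRep I g z 0 y v v ≤ ‖chartRep I g z 0 y‖ * ‖v‖ * ‖v‖ :=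
        (le_abs_self _).trans (abs_apply₂_le _ v v)
      have h2 : ‖chartRep I g z 0 y‖ * ‖v‖ * ‖v‖ ≤ M₀ * ‖v‖ * ‖v‖ := by gcongr; exact hM₀ y hy
      nlinarith
    have hexp₁ : c ≤ exp (-(2 * L * t)) := by
      rw [hcdef]; exact exp_le_exp.2 (by nlinarith [ht.2.le, ht.1])
    have hexp₂ : exp (2 * L * t) ≤ C := by
      rw [hCdef]; exact exp_le_exp.2 (by nlinarith [ht.2.le, ht.1])
    constructor
    · calc c * lam₀ * ‖v‖ ^ 2 = c * (lam₀ * ‖v‖ ^ 2) := by ring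
        _ ≤ c * chartRep I g z 0 y v v := mul_le_mul_of_nonneg_left h0 hcpos.le
        _ ≤ exp (-(2 * L * t)) * chartRep I g z 0 y v v := mul_le_mul_of_nonneg_right hexp₁ hg0
        _ ≤ chartRep I g z t y v v := hme.1
    · calc chartRep I g z t y v v ≤ exp (2 * L * t) * chartRep I g z 0 y v v := hme.2
        _ ≤ C * chartRep I g z 0 y v v := mul_le_mul_of_nonneg_right hexp₂ hg0
        _ ≤ C * (M₀ * ‖v‖ ^ 2) := mul_le_mul_of_nonneg_left hup hCpos.le
        _ = C * M₀ * ‖v‖ ^ 2 := by ring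
  refine ⟨c * lam₀, mul_pos hcpos hlam₀, 2 * (C * M₀), fun q hq ↦ ⟨fun v ↦ (hcomp q hq v).1, ?_⟩⟩
  have hsymm : ∀ v w, chartRep I g z q.2 q.1 v w = chartRep I g z q.2 q.1 w v :=
    fun v w ↦ chartRep_symm z q.2 (hcl hq.1) v w
  refine norm_le_of_quadratic_le hsymm (mul_nonneg hCpos.le hM₀nn) fun v ↦ ?_
  have h2 : 0 ≤ chartRep I g z q.2 q.1 v v :=
    (mul_nonneg (mul_nonneg hcpos.le hlam₀.le) (sq_nonneg _)).trans (hcomp q hq v).1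
  rw [abs_of_nonneg h2]
  exact (hcomp q hq v).2

/-- **The coordinate Ricci form of the chart representative is the Ricci tensor of `g(t)` on the
frame vectors**: `Ric(chartRep I g z t)(y)(v, w) = Ric_{g_t}(Φ y)(X_v, X_w)`, `Φ` the inverse chart,
`X_v = e.symmL (Φ y) v` (naturality of `Ric` under `Φ`, `ricci_comap_apply`, and
`OpensChart.ricci_eq_ricAt`; the computation inside `tDeriv_chartRep_eq`).
[cite: Topping2006, (1.1.1) and §1.2.3] -/
theorem IsRicciFlow.ricAt_chartRep_eq_ricci (hg : IsRicciFlow g cov S) {t : ℝ} (ht : t ∈ S) (z : M)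
    (y : chartTarget I z) (v w : E) :
    ricAt (chartRep I g z t) y v w =
      (cov t).ricci ((extChartAt I z).symm y)
        ((trivializationAt E (TangentSpace I : M → Type _) z).symmL ℝ ((extChartAt I z).symm y) v)
        ((trivializationAt E (TangentSpace I : M → Type _) z).symmL ℝ ((extChartAt I z).symm y) w) := by
  haveI := (g t).hasLeviCivita
  haveI := (chartPullback I (g t) z).hasLeviCivita
  have h2 : (2 : ℕ∞ω) ≤ ∞ := WithTop.coe_le_coe.mpr le_top
  rw [(hg.isLeviCivita t ht).ricci_eq_ricci h2,
    ← Lorentzian.OpensChart.ricci_eq_ricAt (val_chartPullback_eq_chartRep g z t) y v w,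
    (g t).ricci_comap_apply contMDiff_pullbackBilin_holds (contMDiff_chartInv z)
      (injective_mfderiv_chartInv z) rfl y v w,
    mfderiv_chartInv_eq_symmL z y v, mfderiv_chartInv_eq_symmL z y w]
  rfl

/-- **The Ricci components of the chart representative are bounded** along a Ricci flow of
Riemannian metrics on `[0, T)`, `T > 0`, with `|Rm| ≤ K`: for a basis `b` of the model space and a
closed ball `B̄(ẑ, r') ⊆ target`, `|Ric(chartRep I g z t)(y)(b_i, b_j)| ≤ C` for `y ∈ B̄(ẑ, r')`,
`t ∈ [0, T)` (`|Ric(X,X)| ≤ nK g(X,X)` by `CurvatureBoundedBy.abs_ricci_le`, polarization, and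
`g_t(X_{b_i}, X_{b_i}) = G_t(y)(b_i,b_i) ≤ ‖G_t(y)‖|b_i|²`). This is the case `k = 0` of the bounds on
the components of `∇ᵏRic` that enter Topping's (5.3.3) ⇒ (5.3.4).
[cite: Topping2006, §5.3, proof of Thm. 5.3.1, p. 47] -/
theorem IsRicciFlow.exists_abs_ricAt_chartRep_le {ι : Type*} (b : Basis ι ℝ E) (hT : 0 < T)
    (hg : IsRicciFlow g cov (Ico 0 T)) (hR : ∀ t ∈ Ico 0 T, (g t).IsRiemannian)
    (hK : ∀ t ∈ Ico 0 T, CurvatureBoundedBy (g t) (cov t) K) (z : M) {r' : ℝ} (hr' : 0 ≤ r')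
    (hcl : closedBall (extChartAt I z z) r' ⊆ (extChartAt I z).target) :
    ∃ C : ℝ, ∀ q ∈ closedBall (extChartAt I z z) r' ×ˢ Ico 0 T, ∀ i j : ι,
      |ricAt (chartRep I g z q.2) q.1 (b i) (b j)| ≤ C := by
  classical
  obtain ⟨lam, hlam, C₀, hGb⟩ := hg.exists_chartRep_twoSided hT hR hK z hr' hcl
  -- a common bound for the basis vectors
  haveI : Fintype ι := FiniteDimensional.fintypeBasisIndex b
  obtain ⟨β, hβ⟩ : ∃ β : ℝ, ∀ i, ‖b i‖ ≤ β :=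
    ⟨∑ i, ‖b i‖, fun i ↦ Finset.single_le_sum (f := fun j ↦ ‖b j‖) (fun j _ ↦ norm_nonneg _)
      (Finset.mem_univ i)⟩
  set n : ℝ := (finrank ℝ E : ℝ) with hn
  have hC₀nn : ∀ q ∈ closedBall (extChartAt I z z) r' ×ˢ Ico 0 T, 0 ≤ C₀ := fun q hq ↦
    (norm_nonneg _).trans (hGb q hq).2
  refine ⟨2⁻¹ * (n * K) * C₀ * ((β + β) ^ 2 + β ^ 2 + β ^ 2), ?_⟩
  rintro ⟨y, t⟩ hq i j
  have hy : y ∈ (extChartAt I z).target := hcl hq.1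
  have ht : t ∈ Ico 0 T := hq.2
  have hK0 : 0 ≤ K := (hK t ht).nonneg z
  have hnK : 0 ≤ n * K := mul_nonneg (Nat.cast_nonneg _) hK0
  have hC₀' : 0 ≤ C₀ := hC₀nn (y, t) hq
  have hβ0 : 0 ≤ β := (norm_nonneg _).trans (hβ i)
  -- `|Ric(G)(y)(u,u)| ≤ nK C₀ |u|²` for every `u`
  have hdiag : ∀ u : E, |ricAt (chartRep I g z t) y u u| ≤ n * K * C₀ * ‖u‖ ^ 2 := by
    intro u
    rw [hg.ricAt_chartRep_eq_ricci ht z ⟨y, hy⟩ u u]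
    refine ((hK t ht).abs_ricci_le (hR t ht) _ _).trans ?_
    change (finrank ℝ E : ℝ) * K * chartRep I g z t y u u ≤ _
    rw [← hn]
    have h1 : chartRep I g z t y u u ≤ C₀ * ‖u‖ ^ 2 := by
      have := abs_apply₂_le (chartRep I g z t y) u u
      have h2 : ‖chartRep I g z t y‖ * ‖u‖ * ‖u‖ ≤ C₀ * ‖u‖ * ‖u‖ := by
        gcongr; exact (hGb (y, t) hq).2
      nlinarith [le_abs_self (chartRep I g z t y u u)]
    calc n * K * chartRep I g z t y u u ≤ n * K * (C₀ * ‖u‖ ^ 2) :=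
          mul_le_mul_of_nonneg_left h1 hnK
      _ = n * K * C₀ * ‖u‖ ^ 2 := by ring
  -- polarization for the symmetric form `Ric(G)(y)`
  have hGm : IsMetricOn (chartRep I g z t) (extChartAt I z).target :=
    Lorentzian.OpensChart.isMetricOn_repr (val_chartPullback_eq_chartRep g z t)
  have hpol : ricAt (chartRep I g z t) y (b i) (b j) = 2⁻¹ * (ricAt (chartRep I g z t) y (b i + b j)
      (b i + b j) - ricAt (chartRep I g z t) y (b i) (b i) - ricAt (chartRep I g z t) y (b j) (b j)) := by
    simp only [map_add, _root_.add_apply, hGm.ricAt_comm hy (b j) (b i)]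
    ring
  rw [hpol, abs_mul, abs_of_pos (by norm_num : (0 : ℝ) < 2⁻¹)]
  have h3 := hdiag (b i + b j)
  have h4 := hdiag (b i)
  have h5 := hdiag (b j)
  have hnorm : ‖b i + b j‖ ≤ β + β := (norm_add_le _ _).trans (add_le_add (hβ i) (hβ j))
  calc 2⁻¹ * |ricAt (chartRep I g z t) y (b i + b j) (b i + b j) - ricAt (chartRep I g z t) y (b i) (b i)
        - ricAt (chartRep I g z t) y (b j) (b j)|
      ≤ 2⁻¹ * (n * K * C₀ * ‖b i + b j‖ ^ 2 + n * K * C₀ * ‖b i‖ ^ 2 + n * K * C₀ * ‖b j‖ ^ 2) := by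
        gcongr
        refine (abs_sub _ _).trans (add_le_add ((abs_sub _ _).trans (add_le_add h3 h4)) h5)
    _ ≤ 2⁻¹ * (n * K * C₀ * (β + β) ^ 2 + n * K * C₀ * β ^ 2 + n * K * C₀ * β ^ 2) := by
        have hnn : 0 ≤ n * K * C₀ := mul_nonneg hnK hC₀'
        have e1 : ‖b i + b j‖ ^ 2 ≤ (β + β) ^ 2 := pow_le_pow_left₀ (norm_nonneg _) hnorm 2
        have e2 : ‖b i‖ ^ 2 ≤ β ^ 2 := pow_le_pow_left₀ (norm_nonneg _) (hβ i) 2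
        have e3 : ‖b j‖ ^ 2 ≤ β ^ 2 := pow_le_pow_left₀ (norm_nonneg _) (hβ j) 2
        have f1 := mul_le_mul_of_nonneg_left e1 hnn
        have f2 := mul_le_mul_of_nonneg_left e2 hnn
        have f3 := mul_le_mul_of_nonneg_left e3 hnn
        linarith
    _ = 2⁻¹ * (n * K) * C₀ * ((β + β) ^ 2 + β ^ 2 + β ^ 2) := by ring

end Literature.Geometry.Riemannian

end
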